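import Summits.ResolutionOfSingularities.ResolutionOfSingularities.Theorems.FrobeniusClosingPatchingRelPerfectDepthSepPeelAll
import Summits.ResolutionOfSingularities.ResolutionOfSingularities.Theorems.FrobeniusClosingPatchingRelPerfectDepthSepCJS
import HarnessLib

/-!
# Crux `PatchingRelPerfect` (stmt-ResolutionOfSingularities-16161), chain W5.2 — F6 STAGE 2: target T6-E2 `SeparationBoundaryNil₃` (R2a/R2b) BY NAME

[OURS · L1 W5.2 · TargetsF6 v1.2 (`…DepthSepTargets`) target T6-E2] NOT a statement of the manuscript under review; AI-written (AI
review is weaker than expert review).  The named fact `CossartJannsenSaito2020EmbeddedSequenceB` (F-32bR) enters as a hypothesis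
INSIDE the target, nowhere else.

`DepthTargets.separationBoundaryNil₃_holds : SeparationBoundaryNil₃` = PHASE A (res-D-pv-054: Cossart–Jannsen–Saito with empty boundary
transported into `IsSepSeq`, `SepPhaseA.phaseA`) followed by PHASE B (res-L1-w52-stub-1: PEEL-ALL,
`DepthSep.exists_isSepSeq_endSep_of_phaseA`).  Route and END (`𝔟' = ⊤`, complete separation) per res-L1-w52-plan-1 g8 RULING R2a.

## References
* V. Cossart, U. Jannsen, S. Saito, LNM 2270 (2020), Thm. 1.4. [CossartJannsenSaito2020]
* J. Kollár, *Lectures on Resolution of Singularities* (2007), (3.111) Step 3. [Kollar2007]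
-/

-- `Summit.<Summit>.<Sub>.Theorems` with `Sub = Summit` (single-conjunct summit, D-0017)
set_option linter.dupNamespace false

noncomputable section

open CategoryTheory AlgebraicGeometry TopologicalSpace
open Literature.AlgebraicGeometry.Resolution

namespace Summit.ResolutionOfSingularities.ResolutionOfSingularities.Theorems.DepthTargets

universe u

/-- [OURS · L1 W5.2] **TARGET T6-E2 `SeparationBoundaryNil₃` HOLDS** (modulo F-32bR, which is the antecedent of the target): on an
integral Noetherian regular excellent threefold every non-zero locally principal `𝔟` is carried by a weight-one `IsSepSeq` (empty
initial boundary) to the END of stage 2 — in fact to `𝔟' = ⊤` (host and `E` separated).  Phase A ∘ Phase B.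
[cite: CossartJannsenSaito2020, Thm. 1.4] [cite: Kollar2007, (3.111) Step 3] -/
theorem separationBoundaryNil₃_holds : SeparationBoundaryNil₃.{u} := by
  intro hCJS E _ _ hreg hexc hdim 𝔟 h𝔟 hlp
  exact DepthSep.exists_isSepSeq_endSep_of_phaseA (SepPhaseA.phaseA hCJS E hreg hexc hdim 𝔟 h𝔟 hlp)

/-- [OURS · L1 W5.2] **The STRONGER form actually produced: the END state is `𝔟' = ⊤`** (host and `E` DISJOINT — complete
separation), on an integral Noetherian regular `E'`, the final boundary drawn from one snc family and `⊤`.  For an X-side END that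
prefers to read `K.comap i = ⊤` instead of `EndSep`. [cite: CossartJannsenSaito2020, Thm. 1.4] [cite: Kollar2007, (3.111) Step 3] -/
theorem exists_isSepSeq_top_nil₃ (hCJS : CossartJannsenSaito2020EmbeddedSequenceB.{u}) (E : Scheme.{u}) [IsIntegral E]
    [IsNoetherian E] (hreg : Scheme.IsRegular E) (hexc : Scheme.IsExcellent E) (hdim : topologicalKrullDim E = 3)
    (𝔟 : E.IdealSheafData) (h𝔟 : 𝔟 ≠ ⊥) (hlp : IsLocallyPrincipal 𝔟) :
    ∃ (E' : Scheme.{u}) (ρ : E' ⟶ E) (_ : IsIntegral E') (_ : IsNoetherian E') (𝓔₀ : List E'.IdealSheafData)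
      (𝒟' : List (E'.IdealSheafData × ℕ)), Scheme.IsRegular E' ∧ HasSNC 𝓔₀ ∧ (∀ D ∈ boundaryOf 𝒟', D ∈ 𝓔₀ ∨ D = ⊤) ∧
        IsSepSeq ρ 𝔟 ([] : List (E.IdealSheafData × ℕ)) ⊤ 𝒟' := by
  obtain ⟨E', ρ, hint, hnoeth, 𝓔₀, 𝒮, 𝒟, hreg', h𝓔₀, h𝒮, h𝒟, hseq⟩ := SepPhaseA.phaseA hCJS E hreg hexc hdim 𝔟 h𝔟 hlp
  haveI := hnoeth
  obtain ⟨ρ', 𝒟', h𝒟', hseq', -⟩ := DepthSep.exists_isSepSeq_endSep_of_mid h𝓔₀ 𝒮 h𝒮 h𝒟 hseq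
  exact ⟨E', ρ', hint, hnoeth, 𝓔₀, 𝒟', hreg', h𝓔₀, h𝒟', hseq'⟩

end Summit.ResolutionOfSingularities.ResolutionOfSingularities.Theorems.DepthTargets
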